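import Literature.AlgebraicGeometry.Frobenioids.DivisorMonoidIsoDescent
import Literature.AlgebraicGeometry.Frobenioids.DivisorMonoidCategoryTheoreticityCorProofs
import Literature.AlgebraicGeometry.Frobenioids.DivisorMonoidCategoryTheoreticityFacts
import HarnessLib

/-!
# Frobenioids I, Corollary 4.11 (iii) — PROOF modulo Corollary 4.11 (ii) and Theorem 4.9 (typed)

Mochizuki, *The geometry of Frobenioids I: the general theory*, Kyushu J. Math. **62** (2008)
293–400, kurims text proof of Cor. 4.11 p. 94: "assertion (iii) follows formally from assertion (ii);
Theorem 4.9 … Finally, we consider assertion (iv). … the existence of a 1-commutative diagram as in the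
statement of assertion (iv) now follows simply by concatenating assertions (ii), (iii), with the fact that
`Ψ` preserves Frobenius degrees [cf. Theorem 3.4, (iii)]" [cite: MochizukiFrdI2008, Cor. 4.11 (iv) p.94].

PROOF-ONLY companion of `DivisorMonoidCategoryTheoreticity.lean` (seat abc-iut-L1-t3). Honest conditional
discharge — the inputs are t3's typed conclusion predicates, the glue is kernel-checked:

* `cor411iii_of_cor411ii_of_thm49` (generic `PreFrobenioidData`): Cor. 4.11 (iii) from the typed
  Cor. 4.11 (ii) and Thm. 4.9 for `Ψ`, under Def. 1.3 (i)(a)(b)(c) of `C₁ → D₁` in operations form — the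
  descent `DivisorMonoidIsoOver.exists_overBase`;
* `PreFrobenioid.exists_preSteps_of_base_iso`, `PreFrobenioid.exists_arrow_over_base`: Def. 1.3 (i)(b), (c)
  of a Frobenioid `C → F_Φ` in the operations form used above ((i)(a) is
  `PreFrobenioid.exists_base_iso_of_isFrobenioid`);
* `PreFrobenioid.cor411iii_of_fact_of_thm49`: the same for Frobenioids `C_i → F_{Φ_i}`, conditional on the
  named fact `FrdI.Cor411ii` and the typed Thm. 4.9 for `Ψ`.

Cor. 4.11 (iv) ("by concatenating assertions (ii), (iii), with the fact that `Ψ` preserves Frobenius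
degrees") is assembled in `DivisorMonoidCategoryTheoreticityCorProofsIV.lean`.

No statement of the paper is strengthened; nothing here is specific to the abc programme.
-/

namespace Literature.AlgebraicGeometry.Frobenioids

open CategoryTheory Opposite

universe w w₁ w₂ v v' v₁ v₁' v₂ v₂' u u' u₁ u₁' u₂ u₂'

namespace PreFrobenioidData

section TwoFrobenioids

variable {C₁ : Type u₁} [Category.{v₁} C₁] {D₁ : Type u₁'} [Category.{v₁'} D₁]
variable {C₂ : Type u₂} [Category.{v₂} C₂] {D₂ : Type u₂'} [Category.{v₂'} D₂]
variable (S₁ : PreFrobenioidData.{w₁} C₁ D₁) (S₂ : PreFrobenioidData.{w₂} C₂ D₂) (Ψ : C₁ ≌ C₂)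

/-- **Corollary 4.11 (iii)**, DISCHARGED modulo the typed Cor. 4.11 (ii) and Thm. 4.9 for `Ψ` ("assertion
(iii) follows formally from assertion (ii); Theorem 4.9", FrdI p. 94), for `C₁ → D₁` satisfying
Def. 1.3 (i)(a)(b)(c) in operations form: the `Ψ^Base` of (ii), and `Ψ^Φ` over `Ψ` descended to an
isomorphism `Φ₁ ⥲ Φ₂` ON `D₁` lying over `Ψ^Base`. [cite: MochizukiFrdI2008, Cor. 4.11 (iii) p.92] -/
theorem cor411iii_of_cor411ii_of_thm49 (R₁ : S₁.RSParams) (R₂ : S₂.RSParams)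
    (hbase : ∀ X : D₁, ∃ A : C₁, Nonempty (S₁.base.obj A ≅ X))
    (hconn : ∀ (A B : C₁) (g : S₁.base.obj A ≅ S₁.base.obj B), ∃ (X : C₁) (φ : X ⟶ A) (ψ : X ⟶ B),
      IsIso (S₁.base.map φ) ∧ S₁.base.map φ ≫ g.hom = S₁.base.map ψ)
    (hpb : ∀ (A : C₁) {Y : D₁} (f : Y ⟶ S₁.base.obj A),
      ∃ (A' : C₁) (φ : A' ⟶ A) (e : S₁.base.obj A' ≅ Y), S₁.base.map φ = e.hom ≫ f)
    (h2 : Cor411ii S₁ S₂ Ψ) (h49 : Thm49 S₁ S₂ Ψ R₁ R₂) : Cor411iii S₁ S₂ Ψ R₁ R₂ := by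
  intro hs hR₁ hR₂
  obtain ⟨ΨBase, hsq, -⟩ := h2 hs
  obtain ⟨E⟩ := h49 hR₁ hR₂
  obtain ⟨η⟩ := hsq.2.1
  obtain ⟨E', -⟩ := E.exists_overBase ΨBase η hbase hconn hpb
  exact ⟨ΨBase, hsq, ⟨E'⟩⟩

end TwoFrobenioids

end PreFrobenioidData

namespace PreFrobenioid

section OneFrobenioid

variable {D : Type u} [Category.{v} D] {Φ : Dᵒᵖ ⥤ CommMonCat.{w}} {C : Type u'} [Category.{v'} C]
  (F : C ⥤ ElemFrobenioid Φ)

/-- Def. 1.3 (i)(b) of a Frobenioid in operations form: every base-isomorphism `g : Base A ≅ Base B` is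
`Base(ψ) ∘ Base(φ)⁻¹` for pre-steps (in particular base-isomorphisms) `φ : X → A`, `ψ : X → B`.
[cite: MochizukiFrdI2008, Def. 1.3 (i) p.24] -/
theorem exists_preSteps_of_base_iso (hF : IsFrobenioid F) (A B : C)
    (g : (PreFrobenioidData.ofFunctor Φ F).base.obj A ≅ (PreFrobenioidData.ofFunctor Φ F).base.obj B) :
    ∃ (X : C) (φ : X ⟶ A) (ψ : X ⟶ B), IsIso ((PreFrobenioidData.ofFunctor Φ F).base.map φ) ∧
      (PreFrobenioidData.ofFunctor Φ F).base.map φ ≫ g.hom = (PreFrobenioidData.ofFunctor Φ F).base.map ψ := by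
  obtain ⟨X, φ, ψ, hφ, -, h⟩ := hF.i_b A B g
  exact ⟨X, φ, ψ, hφ.2, h⟩

/-- Def. 1.3 (i)(c) of a Frobenioid in operations form ("`C^pl-bk_A → D_{Base A}` is an equivalence", here
only its essential surjectivity): every `f : Y → Base A` is, up to an isomorphism `e : Base A' ≅ Y`, the
base of a (pull-back) morphism `φ : A' → A`. [cite: MochizukiFrdI2008, Def. 1.3 (i) p.24] -/
theorem exists_arrow_over_base (hF : IsFrobenioid F) (A : C) {Y : D}
    (f : Y ⟶ (PreFrobenioidData.ofFunctor Φ F).base.obj A) :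
    ∃ (A' : C) (φ : A' ⟶ A) (e : (PreFrobenioidData.ofFunctor Φ F).base.obj A' ≅ Y),
      (PreFrobenioidData.ofFunctor Φ F).base.map φ = e.hom ≫ f := by
  haveI := hF.i_c A
  let T : Over ((wideSubcategoryInclusion (pullbackMorphisms F) ⋙ baseFunctor F).obj ⟨A⟩) := Over.mk f
  let P := (pullbackSliceToBase F A).objPreimage T
  let i : (pullbackSliceToBase F A).obj P ≅ T := (pullbackSliceToBase F A).objObjPreimageIso T
  refine ⟨P.left.obj, P.hom.hom,
    (Over.forget ((wideSubcategoryInclusion (pullbackMorphisms F) ⋙ baseFunctor F).obj ⟨A⟩)).mapIso i, ?_⟩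
  exact (Over.w i.hom).symm

end OneFrobenioid

section Facts

universe wf vf vf' uf uf'

variable {D₁ : Type uf} [Category.{vf} D₁] {Φ₁ : D₁ᵒᵖ ⥤ CommMonCat.{wf}}
  {C₁ : Type uf'} [Category.{vf'} C₁] (F₁ : C₁ ⥤ ElemFrobenioid Φ₁)
  {D₂ : Type uf} [Category.{vf} D₂] {Φ₂ : D₂ᵒᵖ ⥤ CommMonCat.{wf}}
  {C₂ : Type uf'} [Category.{vf'} C₂] (F₂ : C₂ ⥤ ElemFrobenioid Φ₂)
  (Ψ : C₁ ≌ C₂)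

/-- **Corollary 4.11 (iii)** for Frobenioids `C_i → F_{Φ_i}` with `Φ_i` perf-factorial, conditional on the
named fact [FrdI] Cor. 4.11 (ii) (`FrdI.Cor411ii`) and on the typed Thm. 4.9 for `Ψ` ("(iii) follows
formally from (ii); Theorem 4.9", FrdI p. 94). [cite: MochizukiFrdI2008, Cor. 4.11 (iii) p.92] -/
theorem cor411iii_of_fact_of_thm49 (h411 : FrdI.Cor411ii.{wf, vf, vf', uf, uf'}) (hF₁ : IsFrobenioid F₁)
    (hF₂ : IsFrobenioid F₂) (hpf₁ : ∀ X : D₁, IsPerfFactorial (Φ₁.obj (op X)))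
    (hpf₂ : ∀ X : D₂, IsPerfFactorial (Φ₂.obj (op X)))
    (R₁ : (PreFrobenioidData.ofFunctor Φ₁ F₁).RSParams) (R₂ : (PreFrobenioidData.ofFunctor Φ₂ F₂).RSParams)
    (h49 : (PreFrobenioidData.ofFunctor Φ₁ F₁).Thm49 (PreFrobenioidData.ofFunctor Φ₂ F₂) Ψ R₁ R₂) :
    (PreFrobenioidData.ofFunctor Φ₁ F₁).Cor411iii (PreFrobenioidData.ofFunctor Φ₂ F₂) Ψ R₁ R₂ :=
  PreFrobenioidData.cor411iii_of_cor411ii_of_thm49 _ _ Ψ R₁ R₂ (exists_base_iso_of_isFrobenioid F₁ hF₁)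
    (exists_preSteps_of_base_iso F₁ hF₁) (fun A _ f => exists_arrow_over_base F₁ hF₁ A f)
    (h411 F₁ F₂ hF₁ hF₂ hpf₁ hpf₂ Ψ) h49

end Facts

end PreFrobenioid

end Literature.AlgebraicGeometry.Frobenioids
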